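import Mathlib.Probability.Moments.MGFAnalytic
import Literature.Barriers.CriticalPhenomena.RigorousRGSmallParameterHHWReduction
import Literature.Barriers.CriticalPhenomena.RigorousRGSmallParameterHHWFlowIneq
import HarnessLib

/-!
# HHW §3 for measures: the Gaussian-tilted flow of truncated correlations and Proposition 3.1

Companion to `RigorousRGSmallParameterHHWFlowIneq.lean` (the analytic core of Hara–Hattori–
Watanabe 2001, Proposition 3.1, for abstract solutions of (3.6)–(3.9)) and to
`RigorousRGSmallParameterHHWReduction.lean` (the trajectory `traj`, the truncated correlations
`mu2`, `mu4`, `mu6`, `mu8` of a law). Here the abstract flow is realised by MEASURES: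

* `sqTilt ν t = e^{t x²}ν / Z_t` — the Gaussian tilt; the block-spin map is
  `rgMap c ν = sqTilt (S ν) (β/2)` with `S ν = (ν ∗ ν).map ((√c/2)·)` ((2.3)–(2.5), (3.3):
  `T = e^{-(β/2)Δ}` on the Fourier side is the tilt by `e^{βx²/2}`);
* `hasDerivAt_mK` — for a bounded law the tilted moments `m_{2k}(t) = ∫ x^{2k} dν_t` are
  differentiable with `m_{2k}' = m_{2k+2} - m_{2k} m_2` (Mathlib's
  `hasDerivAt_integral_pow_mul_exp_real` for `X = x²`);
* `mu10` ((2.7), the `ξ¹⁰` coefficient of `-log ĥ`, entering (3.9)) and the moment forms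
  `mu6_eq_moments`, `mu8_eq_moments`, `mu10_eq_moments`;
* `hasDerivAt_mu2_sqTilt` … `hasDerivAt_mu8_sqTilt` — **the ODE system (3.6)–(3.9) holds for
  `t ↦ μ_{2n}(ν_t)`** (polynomial identities in the moments, given `m_{2k}'`; no symmetry needed);
* `NewmanPos`, `truncFlow_sqTilt` — with Newman's positivity (3.10) along `[0, T]` and
  `4 μ₂(ν) T < 1`, the functions `t ↦ μ_{2n}(ν_t)` form a `TruncFlow` (so the conclusions of
  `RigorousRGSmallParameterHHWFlowIneq` apply);
* `integral_pow_dbl`, `mu2_dbl` … `mu10_dbl` — **(3.2)**: for a symmetric bounded law,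
  `μ_{2n}(S ν) = 2 (c/4)ⁿ μ_{2n}(ν)` (`n ≤ 5`; binomial expansion of `∫(x+y)^{2n}` under `ν ⊗ ν`);
* `StepHyp`, `StepHyp.ineq314` … `StepHyp.ineq324` — **Proposition 3.1 for a law `ν`** (`d = 4`,
  `c = √2`): if `ν` is bounded and symmetric, `0 < μ₂(ν) < 2 + √2` ((3.13)) and the tilts
  `(S ν)_t`, `t ∈ [0, β/2]`, are Newman-positive, then `μ_{2n}(Rν)` obey (3.14), (3.15),
  (3.19)–(3.24) as printed, with `r_N = rN (μ₂ ν)` ((3.11)) and `ζ_N = zetaN (μ₂ ν)` ((3.12)); (3.21)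
  under (3.16) alone.

## References

* T. Hara, T. Hattori, H. Watanabe, Comm. Math. Phys. 220 (2001) 13–40, §2.1 (2.2)–(2.7), §3
  (3.1)–(3.13), Proposition 3.1.
-/

noncomputable section

namespace Literature.Barriers.CriticalPhenomena

open _root_.MeasureTheory _root_.ProbabilityTheory _root_.Filter _root_.Set _root_.Finset
open scoped _root_.Topology _root_.ENNReal _root_.NNReal BigOperators

namespace HierarchicalRG

/-! ### `μ_10` and the moment forms of `μ_6, μ_8, μ_10` -/

/-- The truncated ten-point correlation, the `ξ¹⁰`-coefficient of `V = -log ĥ` ((2.7)):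
`μ_10 = a_1⁵/5 - a_1³a_2/2 + a_1²a_3/6 + a_1a_2²/4 - a_1a_4/24 - a_2a_3/12 + a_5/120` (it enters the
flow only through (3.9)). [cite: HaraHattoriWatanabe2001, §2.1 eq. (2.7) and §3.1 eq. (3.9)] -/
def mu10 (ν : Measure ℝ) : ℝ :=
  taylorA ν 1 ^ 5 / 5 - taylorA ν 1 ^ 3 * taylorA ν 2 / 2 + taylorA ν 1 ^ 2 * taylorA ν 3 / 6 +
    taylorA ν 1 * taylorA ν 2 ^ 2 / 4 - taylorA ν 1 * taylorA ν 4 / 24 -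
    taylorA ν 2 * taylorA ν 3 / 12 + taylorA ν 5 / 120

/-- `μ_6 = m_2³/24 - m_2m_4/48 + m_6/720`. [cite: HaraHattoriWatanabe2001, §5.1 (p. 15)] -/
theorem mu6_eq_moments (ν : Measure ℝ) :
    mu6 ν = (∫ x, x ^ 2 ∂ν) ^ 3 / 24 - (∫ x, x ^ 2 ∂ν) * (∫ x, x ^ 4 ∂ν) / 48 +
      (∫ x, x ^ 6 ∂ν) / 720 := by
  simp [mu6, taylorA, moment_id_eq, Nat.factorial]
  ring

/-- `μ_8 = m_2⁴/64 - m_2²m_4/96 + m_4²/1152 + m_2m_6/1440 - m_8/40320`.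
[cite: HaraHattoriWatanabe2001, §5.1 (p. 15)] -/
theorem mu8_eq_moments (ν : Measure ℝ) :
    mu8 ν = (∫ x, x ^ 2 ∂ν) ^ 4 / 64 - (∫ x, x ^ 2 ∂ν) ^ 2 * (∫ x, x ^ 4 ∂ν) / 96 +
      (∫ x, x ^ 4 ∂ν) ^ 2 / 1152 + (∫ x, x ^ 2 ∂ν) * (∫ x, x ^ 6 ∂ν) / 1440 -
      (∫ x, x ^ 8 ∂ν) / 40320 := by
  simp [mu8, taylorA, moment_id_eq, Nat.factorial]
  ring

/-- `μ_10 = m_2⁵/160 - m_2³m_4/192 + m_2²m_6/2880 + m_2m_4²/1152 - m_2m_8/80640 - m_4m_6/17280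
+ m_10/3628800`. [cite: HaraHattoriWatanabe2001, §5.1 (p. 15)] -/
theorem mu10_eq_moments (ν : Measure ℝ) :
    mu10 ν = (∫ x, x ^ 2 ∂ν) ^ 5 / 160 - (∫ x, x ^ 2 ∂ν) ^ 3 * (∫ x, x ^ 4 ∂ν) / 192 +
      (∫ x, x ^ 2 ∂ν) ^ 2 * (∫ x, x ^ 6 ∂ν) / 2880 + (∫ x, x ^ 2 ∂ν) * (∫ x, x ^ 4 ∂ν) ^ 2 / 1152 -
      (∫ x, x ^ 2 ∂ν) * (∫ x, x ^ 8 ∂ν) / 80640 - (∫ x, x ^ 4 ∂ν) * (∫ x, x ^ 6 ∂ν) / 17280 +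
      (∫ x, x ^ 10 ∂ν) / 3628800 := by
  simp [mu10, taylorA, moment_id_eq, Nat.factorial]
  ring

/-! ### The Gaussian-tilted family `ν_t` -/

/-- The Gaussian tilt `ν_t = e^{t x²} ν / ∫ e^{t x²} dν` — on the Fourier side `e^{-tΔ}`, the
semigroup `g_t` of (3.3); `R = (tilt at t = β/2) ∘ S`. [cite: HaraHattoriWatanabe2001, §3.1 eq. (3.3)] -/
def sqTilt (ν : Measure ℝ) (t : ℝ) : Measure ℝ := ν.tilted fun x => t * x ^ 2

/-- **`R = T S`** ((2.3)): `rgMap c ν` is the `t = β/2` tilt of `S ν = (ν ∗ ν).map ((√c/2)·)`.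
[cite: HaraHattoriWatanabe2001, §2.1 eqs. (2.3)–(2.5)] -/
theorem rgMap_eq_sqTilt (c : ℝ) (ν : Measure ℝ) :
    rgMap c ν = sqTilt ((ν ∗ ν).map fun x => Real.sqrt c / 2 * x) (beta c / 2) := rfl

/-- `ν_0 = ν` for a probability law. [folklore] -/
theorem sqTilt_zero (ν : Measure ℝ) [IsProbabilityMeasure ν] : sqTilt ν 0 = ν := by
  have : (fun x : ℝ => (0 : ℝ) * x ^ 2) = 0 := by ext; simp
  rw [sqTilt, this, tilted_zero]

/-- `φ_k(t) = ∫ (x²)ᵏ e^{t x²} dν`. [folklore] -/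
def phiK (ν : Measure ℝ) (k : ℕ) (t : ℝ) : ℝ := ∫ x, (x ^ 2) ^ k * Real.exp (t * x ^ 2) ∂ν

/-- The tilted even moments `m_{2k}(t) = ∫ x^{2k} dν_t`. [cite: HaraHattoriWatanabe2001, §3.1 (p. 7)] -/
def mK (ν : Measure ℝ) (k : ℕ) (t : ℝ) : ℝ := ∫ x, x ^ (2 * k) ∂(sqTilt ν t)

section Bounded

variable {ν : Measure ℝ}

/-- For a bounded law, `e^{t x²}` is integrable for every `t`. [folklore] -/
theorem IsBddLaw.integrable_exp_mul_sq (h : IsBddLaw ν) (t : ℝ) :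
    Integrable (fun x : ℝ => Real.exp (t * x ^ 2)) ν := by
  haveI := h.isProbabilityMeasure
  obtain ⟨R, hR⟩ := h.exists_bound
  refine Integrable.of_bound (by fun_prop) (Real.exp (|t| * R ^ 2)) ?_
  filter_upwards [hR] with x hx
  rw [Real.norm_eq_abs, Real.abs_exp, Real.exp_le_exp]
  have hx2 : x ^ 2 ≤ R ^ 2 := by
    rw [← sq_abs x]
    exact pow_le_pow_left₀ (abs_nonneg x) hx 2
  calc t * x ^ 2 ≤ |t| * x ^ 2 := mul_le_mul_of_nonneg_right (le_abs_self t) (sq_nonneg x)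
    _ ≤ |t| * R ^ 2 := mul_le_mul_of_nonneg_left hx2 (abs_nonneg t)

/-- For a bounded law every `t` is interior to the domain of the Laplace transform of `x²`.
[folklore] -/
theorem IsBddLaw.mem_interior_integrableExpSet (h : IsBddLaw ν) (t : ℝ) :
    t ∈ interior (integrableExpSet (fun x : ℝ => x ^ 2) ν) := by
  have : integrableExpSet (fun x : ℝ => x ^ 2) ν = univ :=
    Set.eq_univ_of_forall fun u => h.integrable_exp_mul_sq u
  rw [this, interior_univ]
  trivial

/-- `φ_k' = φ_{k+1}` (differentiation under the integral, bounded support). [folklore] -/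
theorem IsBddLaw.hasDerivAt_phiK (h : IsBddLaw ν) (k : ℕ) (t : ℝ) :
    HasDerivAt (phiK ν k) (phiK ν (k + 1) t) t :=
  hasDerivAt_integral_pow_mul_exp_real (h.mem_interior_integrableExpSet t) k

/-- `φ_0(t) = ∫ e^{t x²} dν > 0`. [folklore] -/
theorem IsBddLaw.phiK_zero_pos (h : IsBddLaw ν) (t : ℝ) : 0 < phiK ν 0 t := by
  haveI := h.isProbabilityMeasure
  simp only [phiK, pow_zero, one_mul]
  exact integral_exp_pos (h.integrable_exp_mul_sq t)

/-- The tilted moments are `m_{2k}(t) = φ_k(t)/φ_0(t)`. [folklore] -/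
theorem mK_eq_div (ν : Measure ℝ) (k : ℕ) (t : ℝ) : mK ν k t = phiK ν k t / phiK ν 0 t := by
  simp only [mK, sqTilt, integral_tilted, smul_eq_mul, phiK, pow_zero, one_mul]
  rw [← integral_div]
  refine integral_congr_ae (ae_of_all _ fun x => ?_)
  simp only [pow_mul]
  ring

/-- **The tilted moments are differentiable in `t`, `m_{2k}' = m_{2k+2} - m_{2k} m_2`.**
[cite: HaraHattoriWatanabe2001, §3.1 (derivation of (3.5) from (3.4))] -/
theorem IsBddLaw.hasDerivAt_mK (h : IsBddLaw ν) (k : ℕ) (t : ℝ) :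
    HasDerivAt (mK ν k) (mK ν (k + 1) t - mK ν k t * mK ν 1 t) t := by
  have hφ : ∀ j, mK ν j = fun u => phiK ν j u / phiK ν 0 u := fun j => funext (mK_eq_div ν j)
  have h0 := (h.phiK_zero_pos t).ne'
  rw [hφ k]
  refine ((h.hasDerivAt_phiK k t).div (h.hasDerivAt_phiK 0 t) h0).congr_deriv ?_
  simp only [mK_eq_div, zero_add]
  field_simp

/-- `a_n(ν_t) = n!/(2n)! · m_{2n}(t)`. [cite: HaraHattoriWatanabe2001, §5.1 eq. (5.1)] -/
theorem taylorA_sqTilt (ν : Measure ℝ) (n : ℕ) (t : ℝ) :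
    taylorA (sqTilt ν t) n = (n.factorial : ℝ) / ((2 * n).factorial : ℝ) * mK ν n t := by
  rw [taylorA, moment_id_eq, mK]

/-- `μ_2(ν_t)` in the tilted moments. [cite: HaraHattoriWatanabe2001, §5.1 (p. 15)] -/
theorem mu2_sqTilt (ν : Measure ℝ) (t : ℝ) : mu2 (sqTilt ν t) = mK ν 1 t / 2 := by
  simp [mu2, taylorA_sqTilt, Nat.factorial]
  ring

/-- `μ_4(ν_t)` in the tilted moments. [cite: HaraHattoriWatanabe2001, §5.1 (p. 15)] -/
theorem mu4_sqTilt (ν : Measure ℝ) (t : ℝ) :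
    mu4 (sqTilt ν t) = mK ν 1 t ^ 2 / 8 - mK ν 2 t / 24 := by
  simp [mu4, taylorA_sqTilt, Nat.factorial]
  ring

/-- `μ_6(ν_t)` in the tilted moments. [cite: HaraHattoriWatanabe2001, §5.1 (p. 15)] -/
theorem mu6_sqTilt (ν : Measure ℝ) (t : ℝ) :
    mu6 (sqTilt ν t) = mK ν 1 t ^ 3 / 24 - mK ν 1 t * mK ν 2 t / 48 + mK ν 3 t / 720 := by
  simp [mu6, taylorA_sqTilt, Nat.factorial]
  ring

/-- `μ_8(ν_t)` in the tilted moments. [cite: HaraHattoriWatanabe2001, §5.1 (p. 15)] -/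
theorem mu8_sqTilt (ν : Measure ℝ) (t : ℝ) :
    mu8 (sqTilt ν t) = mK ν 1 t ^ 4 / 64 - mK ν 1 t ^ 2 * mK ν 2 t / 96 + mK ν 2 t ^ 2 / 1152 +
      mK ν 1 t * mK ν 3 t / 1440 - mK ν 4 t / 40320 := by
  simp [mu8, taylorA_sqTilt, Nat.factorial]
  ring

/-- `μ_10(ν_t)` in the tilted moments. [cite: HaraHattoriWatanabe2001, §5.1 (p. 15)] -/
theorem mu10_sqTilt (ν : Measure ℝ) (t : ℝ) :
    mu10 (sqTilt ν t) = mK ν 1 t ^ 5 / 160 - mK ν 1 t ^ 3 * mK ν 2 t / 192 +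
      mK ν 1 t ^ 2 * mK ν 3 t / 2880 + mK ν 1 t * mK ν 2 t ^ 2 / 1152 -
      mK ν 1 t * mK ν 4 t / 80640 - mK ν 2 t * mK ν 3 t / 17280 + mK ν 5 t / 3628800 := by
  simp [mu10, taylorA_sqTilt, Nat.factorial]
  ring

/-! ### The ODE system (3.6)–(3.9) along the tilted family -/

/-- **(3.6)**: `d/dt μ_2(ν_t) = 4μ_2² - 12μ_4`. [cite: HaraHattoriWatanabe2001, §3.1 eq. (3.6)] -/
theorem IsBddLaw.hasDerivAt_mu2_sqTilt (h : IsBddLaw ν) (t : ℝ) :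
    HasDerivAt (fun t => mu2 (sqTilt ν t))
      (4 * mu2 (sqTilt ν t) ^ 2 - 12 * mu4 (sqTilt ν t)) t := by
  have e : (fun t => mu2 (sqTilt ν t)) = fun t => mK ν 1 t / 2 := funext (mu2_sqTilt ν)
  rw [e]
  refine ((h.hasDerivAt_mK 1 t).div_const 2).congr_deriv ?_
  rw [mu2_sqTilt, mu4_sqTilt]
  ring

/-- **(3.7)**: `d/dt μ_4(ν_t) = 16μ_2μ_4 - 30μ_6`. [cite: HaraHattoriWatanabe2001, §3.1 eq. (3.7)] -/
theorem IsBddLaw.hasDerivAt_mu4_sqTilt (h : IsBddLaw ν) (t : ℝ) :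
    HasDerivAt (fun t => mu4 (sqTilt ν t))
      (16 * mu2 (sqTilt ν t) * mu4 (sqTilt ν t) - 30 * mu6 (sqTilt ν t)) t := by
  have e : (fun t => mu4 (sqTilt ν t)) = fun t => mK ν 1 t ^ 2 / 8 - mK ν 2 t / 24 :=
    funext (mu4_sqTilt ν)
  rw [e]
  have d1 := h.hasDerivAt_mK 1 t
  have d2 := h.hasDerivAt_mK 2 t
  refine (((d1.pow 2).div_const 8).sub (d2.div_const 24)).congr_deriv ?_
  rw [mu2_sqTilt, mu4_sqTilt, mu6_sqTilt]
  push_cast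
  ring

/-- **(3.8)**: `d/dt μ_6(ν_t) = 24μ_2μ_6 + 16μ_4² - 56μ_8`. [cite: HaraHattoriWatanabe2001, §3.1 eq. (3.8)] -/
theorem IsBddLaw.hasDerivAt_mu6_sqTilt (h : IsBddLaw ν) (t : ℝ) :
    HasDerivAt (fun t => mu6 (sqTilt ν t))
      (24 * mu2 (sqTilt ν t) * mu6 (sqTilt ν t) + 16 * mu4 (sqTilt ν t) ^ 2 -
        56 * mu8 (sqTilt ν t)) t := by
  have e : (fun t => mu6 (sqTilt ν t)) =
      fun t => mK ν 1 t ^ 3 / 24 - mK ν 1 t * mK ν 2 t / 48 + mK ν 3 t / 720 :=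
    funext (mu6_sqTilt ν)
  rw [e]
  have d1 := h.hasDerivAt_mK 1 t
  have d2 := h.hasDerivAt_mK 2 t
  have d3 := h.hasDerivAt_mK 3 t
  refine ((((d1.pow 3).div_const 24).sub ((d1.mul d2).div_const 48)).add
    (d3.div_const 720)).congr_deriv ?_
  rw [mu2_sqTilt, mu4_sqTilt, mu6_sqTilt, mu8_sqTilt]
  push_cast
  ring

/-- **(3.9)**: `d/dt μ_8(ν_t) = 32μ_2μ_8 + 48μ_4μ_6 - 90μ_10`. [cite: HaraHattoriWatanabe2001, §3.1 eq. (3.9)] -/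
theorem IsBddLaw.hasDerivAt_mu8_sqTilt (h : IsBddLaw ν) (t : ℝ) :
    HasDerivAt (fun t => mu8 (sqTilt ν t))
      (32 * mu2 (sqTilt ν t) * mu8 (sqTilt ν t) + 48 * mu4 (sqTilt ν t) * mu6 (sqTilt ν t) -
        90 * mu10 (sqTilt ν t)) t := by
  have e : (fun t => mu8 (sqTilt ν t)) =
      fun t => mK ν 1 t ^ 4 / 64 - mK ν 1 t ^ 2 * mK ν 2 t / 96 + mK ν 2 t ^ 2 / 1152 +
        mK ν 1 t * mK ν 3 t / 1440 - mK ν 4 t / 40320 :=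
    funext (mu8_sqTilt ν)
  rw [e]
  have d1 := h.hasDerivAt_mK 1 t
  have d2 := h.hasDerivAt_mK 2 t
  have d3 := h.hasDerivAt_mK 3 t
  have d4 := h.hasDerivAt_mK 4 t
  refine ((((((d1.pow 4).div_const 64).sub (((d1.pow 2).mul d2).div_const 96)).add
    ((d2.pow 2).div_const 1152)).add ((d1.mul d3).div_const 1440)).sub
    (d4.div_const 40320)).congr_deriv ?_
  rw [mu2_sqTilt, mu4_sqTilt, mu6_sqTilt, mu8_sqTilt, mu10_sqTilt]
  simp only [Pi.pow_apply]
  push_cast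
  ring

/-! ### Packaging: Newman positivity along the tilts gives a `TruncFlow` -/

/-- **Newman's positivity (3.10) along the tilted family on `[0, T]`**, together with
non-degeneracy `μ_2 > 0`: the hypothesis under which the comparison argument of §3.2 runs
("`μ_n(t)` also is a truncated `n` point correlation of a measure to which arguments in [15]
apply, hence an analogue of (2.8) holds"). [cite: HaraHattoriWatanabe2001, §3.2 eq. (3.10)] -/
structure NewmanPos (ν : Measure ℝ) (T : ℝ) : Prop where
  two_pos : ∀ t ∈ Icc (0 : ℝ) T, 0 < mu2 (sqTilt ν t)
  four_nonneg : ∀ t ∈ Icc (0 : ℝ) T, 0 ≤ mu4 (sqTilt ν t)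
  six_nonneg : ∀ t ∈ Icc (0 : ℝ) T, 0 ≤ mu6 (sqTilt ν t)
  eight_nonneg : ∀ t ∈ Icc (0 : ℝ) T, 0 ≤ mu8 (sqTilt ν t)
  ten_nonneg : ∀ t ∈ Icc (0 : ℝ) T, 0 ≤ mu10 (sqTilt ν t)

/-- **The tilted truncated correlations of a bounded, Newman-positive law form a `TruncFlow`**
on `[0, T]` when `4 μ_2(ν) T < 1`. [cite: HaraHattoriWatanabe2001, §3.2 (3.10), (3.13)] -/
theorem IsBddLaw.truncFlow_sqTilt (h : IsBddLaw ν) {T : ℝ} (hT : 0 < T) (hpos : NewmanPos ν T)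
    (hsub : 4 * mu2 ν * T < 1) :
    TruncFlow T (fun t => mu2 (sqTilt ν t)) (fun t => mu4 (sqTilt ν t))
      (fun t => mu6 (sqTilt ν t)) (fun t => mu8 (sqTilt ν t)) (fun t => mu10 (sqTilt ν t)) := by
  haveI := h.isProbabilityMeasure
  exact
  { pos := hT
    deriv2 := fun t _ => h.hasDerivAt_mu2_sqTilt t
    deriv4 := fun t _ => h.hasDerivAt_mu4_sqTilt t
    deriv6 := fun t _ => h.hasDerivAt_mu6_sqTilt t
    deriv8 := fun t _ => h.hasDerivAt_mu8_sqTilt t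
    two_pos := hpos.two_pos
    four_nonneg := hpos.four_nonneg
    six_nonneg := hpos.six_nonneg
    eight_nonneg := hpos.eight_nonneg
    ten_nonneg := hpos.ten_nonneg
    subcrit := by simpa [sqTilt_zero] using hsub }

/-! ### (3.2): the truncated correlations of `S ν = (ν ∗ ν).map ((√c/2)·)` -/

/-- **Moments of the block spin `k(X + X')`**, `X, X'` i.i.d. `∼ ν` bounded:
`∫ xⁿ d(S ν) = kⁿ Σ_j C(n,j) m_j m_{n-j}` (binomial expansion under `ν ⊗ ν`).
[cite: HaraHattoriWatanabe2001, §3.1 eq. (3.2)] -/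
theorem IsBddLaw.integral_pow_dbl (h : IsBddLaw ν) (k : ℝ) (n : ℕ) :
    ∫ x, x ^ n ∂((ν ∗ ν).map fun x => k * x) =
      k ^ n * ∑ j ∈ Finset.range (n + 1),
        (n.choose j : ℝ) * (∫ x, x ^ j ∂ν) * (∫ x, x ^ (n - j) ∂ν) := by
  haveI := h.isProbabilityMeasure
  rw [integral_map (by fun_prop) (by fun_prop)]
  simp_rw [mul_pow]
  rw [integral_const_mul]
  congr 1
  unfold Measure.conv
  rw [integral_map (by fun_prop) (by fun_prop)]
  simp_rw [add_pow]
  rw [integral_finsetSum]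
  · refine Finset.sum_congr rfl fun j _ => ?_
    have e : (fun p : ℝ × ℝ => p.1 ^ j * p.2 ^ (n - j) * (n.choose j : ℝ)) =
        fun p => (n.choose j : ℝ) * (p.1 ^ j * p.2 ^ (n - j)) := by
      ext; ring
    have hpm := integral_prod_mul (μ := ν) (ν := ν) (fun x : ℝ => x ^ j) (fun y : ℝ => y ^ (n - j))
    rw [e, integral_const_mul, hpm]
    ring
  · intro j _
    exact ((h.integrable_pow j).mul_prod (h.integrable_pow (n - j))).mul_const _

/-- **(3.2), `n = 1`**: `μ_2(S ν) = 2k² μ_2(ν)` for a symmetric bounded law (`k = √c/2`).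
[cite: HaraHattoriWatanabe2001, §3.1 eq. (3.2)] -/
theorem IsBddLaw.mu2_dbl (h : IsBddLaw ν) (hodd : ∀ j, Odd j → ∫ x, x ^ j ∂ν = 0) (k : ℝ) :
    mu2 ((ν ∗ ν).map fun x => k * x) = 2 * k ^ 2 * mu2 ν := by
  haveI := h.isProbabilityMeasure
  have h1 : ∫ x, x ∂ν = 0 := by simpa using hodd 1 ⟨0, rfl⟩
  rw [mu2_eq, mu2_eq, h.integral_pow_dbl]
  simp only [Finset.sum_range_succ, Finset.sum_range_zero, zero_add]
  norm_num [Nat.choose, h1]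
  ring

/-- **(3.2), `n = 2`**: `μ_4(S ν) = 2k⁴ μ_4(ν)` for a symmetric bounded law.
[cite: HaraHattoriWatanabe2001, §3.1 eq. (3.2)] -/
theorem IsBddLaw.mu4_dbl (h : IsBddLaw ν) (hodd : ∀ j, Odd j → ∫ x, x ^ j ∂ν = 0) (k : ℝ) :
    mu4 ((ν ∗ ν).map fun x => k * x) = 2 * k ^ 4 * mu4 ν := by
  haveI := h.isProbabilityMeasure
  have h1 : ∫ x, x ∂ν = 0 := by simpa using hodd 1 ⟨0, rfl⟩
  have h3 := hodd 3 ⟨1, rfl⟩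
  rw [mu4_eq, mu4_eq, h.integral_pow_dbl, h.integral_pow_dbl]
  simp only [Finset.sum_range_succ, Finset.sum_range_zero, zero_add]
  norm_num [Nat.choose, h1, h3]
  ring

/-- **(3.2), `n = 3`**: `μ_6(S ν) = 2k⁶ μ_6(ν)` for a symmetric bounded law.
[cite: HaraHattoriWatanabe2001, §3.1 eq. (3.2)] -/
theorem IsBddLaw.mu6_dbl (h : IsBddLaw ν) (hodd : ∀ j, Odd j → ∫ x, x ^ j ∂ν = 0) (k : ℝ) :
    mu6 ((ν ∗ ν).map fun x => k * x) = 2 * k ^ 6 * mu6 ν := by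
  haveI := h.isProbabilityMeasure
  have h1 : ∫ x, x ∂ν = 0 := by simpa using hodd 1 ⟨0, rfl⟩
  have h3 := hodd 3 ⟨1, rfl⟩
  have h5 := hodd 5 ⟨2, rfl⟩
  rw [mu6_eq_moments, mu6_eq_moments, h.integral_pow_dbl, h.integral_pow_dbl, h.integral_pow_dbl]
  simp only [Finset.sum_range_succ, Finset.sum_range_zero, zero_add]
  norm_num [Nat.choose, h1, h3, h5]
  ring

/-- **(3.2), `n = 4`**: `μ_8(S ν) = 2k⁸ μ_8(ν)` for a symmetric bounded law.
[cite: HaraHattoriWatanabe2001, §3.1 eq. (3.2)] -/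
theorem IsBddLaw.mu8_dbl (h : IsBddLaw ν) (hodd : ∀ j, Odd j → ∫ x, x ^ j ∂ν = 0) (k : ℝ) :
    mu8 ((ν ∗ ν).map fun x => k * x) = 2 * k ^ 8 * mu8 ν := by
  haveI := h.isProbabilityMeasure
  have h1 : ∫ x, x ∂ν = 0 := by simpa using hodd 1 ⟨0, rfl⟩
  have h3 := hodd 3 ⟨1, rfl⟩
  have h5 := hodd 5 ⟨2, rfl⟩
  have h7 := hodd 7 ⟨3, rfl⟩
  rw [mu8_eq_moments, mu8_eq_moments, h.integral_pow_dbl, h.integral_pow_dbl, h.integral_pow_dbl,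
    h.integral_pow_dbl]
  simp only [Finset.sum_range_succ, Finset.sum_range_zero, zero_add]
  norm_num [Nat.choose, h1, h3, h5, h7]
  ring

/-- **(3.2), `n = 5`**: `μ_10(S ν) = 2k¹⁰ μ_10(ν)` for a symmetric bounded law.
[cite: HaraHattoriWatanabe2001, §3.1 eq. (3.2)] -/
theorem IsBddLaw.mu10_dbl (h : IsBddLaw ν) (hodd : ∀ j, Odd j → ∫ x, x ^ j ∂ν = 0) (k : ℝ) :
    mu10 ((ν ∗ ν).map fun x => k * x) = 2 * k ^ 10 * mu10 ν := by
  haveI := h.isProbabilityMeasure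
  have h1 : ∫ x, x ∂ν = 0 := by simpa using hodd 1 ⟨0, rfl⟩
  have h3 := hodd 3 ⟨1, rfl⟩
  have h5 := hodd 5 ⟨2, rfl⟩
  have h7 := hodd 7 ⟨3, rfl⟩
  have h9 := hodd 9 ⟨4, rfl⟩
  rw [mu10_eq_moments, mu10_eq_moments, h.integral_pow_dbl, h.integral_pow_dbl, h.integral_pow_dbl,
    h.integral_pow_dbl, h.integral_pow_dbl]
  simp only [Finset.sum_range_succ, Finset.sum_range_zero, zero_add]
  norm_num [Nat.choose, h1, h3, h5, h7, h9]
  ring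

end Bounded

/-! ### Proposition 3.1 for a law (`d = 4`, `c = √2`) -/

/-- `r_N = 1/(√2 - (√2 - 1)μ_{2,N})` ((3.11)), as a function of `μ_{2,N}`.
[cite: HaraHattoriWatanabe2001, Proposition 3.1 eq. (3.11)] -/
def rN (x : ℝ) : ℝ := 1 / (Real.sqrt 2 - (Real.sqrt 2 - 1) * x)

/-- `ζ_N = (√2 r_N - 1)/(√2 μ_{2,N})` ((3.12)), as a function of `μ_{2,N}`.
[cite: HaraHattoriWatanabe2001, Proposition 3.1 eq. (3.12)] -/
def zetaN (x : ℝ) : ℝ := (Real.sqrt 2 * rN x - 1) / (Real.sqrt 2 * x)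

/-- The scaled doubled law `S ν = (ν ∗ ν).map ((√c/2)·)` at `c = √2`: the law of
`2^{-3/4}(X + X')`. [cite: HaraHattoriWatanabe2001, §2.1 eq. (2.4)] -/
def dbl (ν : Measure ℝ) : Measure ℝ := (ν ∗ ν).map fun x => Real.sqrt (Real.sqrt 2) / 2 * x

/-- **The hypotheses of Proposition 3.1 on the law `h_N = ν`** (`d = 4`): `ν` bounded and
symmetric (odd moments vanish), the tilts `(S ν)_t`, `0 ≤ t ≤ β/2`, Newman-positive ((3.10)),
`μ_{2,N} > 0`, and (3.13) `μ_{2,N} < 2 + √2`. [cite: HaraHattoriWatanabe2001, Proposition 3.1] -/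
structure StepHyp (ν : Measure ℝ) : Prop where
  bdd : IsBddLaw ν
  odd : ∀ j, Odd j → ∫ x, x ^ j ∂ν = 0
  pos : NewmanPos (dbl ν) (beta (Real.sqrt 2) / 2)
  two_pos : 0 < mu2 ν
  subcrit : mu2 ν < 2 + Real.sqrt 2

/-! #### `√2` bookkeeping -/

/-- `√2 > 0`. [folklore] -/
theorem sqrt2_pos : 0 < Real.sqrt 2 := Real.sqrt_pos.2 (by norm_num)

/-- `√2² = 2`. [folklore] -/
theorem sqrt2_sq : Real.sqrt 2 ^ 2 = 2 := Real.sq_sqrt (by norm_num)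

/-- `√2³ = 2√2`. [folklore] -/
theorem sqrt2_pow_three : Real.sqrt 2 ^ 3 = 2 * Real.sqrt 2 := by rw [pow_succ, sqrt2_sq]

/-- `√2⁴ = 4`. [folklore] -/
theorem sqrt2_pow_four : Real.sqrt 2 ^ 4 = 4 := by
  rw [pow_succ, sqrt2_pow_three]; nlinarith [sqrt2_sq]

/-- `√2⁵ = 4√2`. [folklore] -/
theorem sqrt2_pow_five : Real.sqrt 2 ^ 5 = 4 * Real.sqrt 2 := by rw [pow_succ, sqrt2_pow_four]

/-- `√2⁶ = 8`. [folklore] -/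
theorem sqrt2_pow_six : Real.sqrt 2 ^ 6 = 8 := by
  rw [pow_succ, sqrt2_pow_five]; nlinarith [sqrt2_sq]

/-- `√2⁷ = 8√2`. [folklore] -/
theorem sqrt2_pow_seven : Real.sqrt 2 ^ 7 = 8 * Real.sqrt 2 := by rw [pow_succ, sqrt2_pow_six]

/-- `√2⁸ = 16`. [folklore] -/
theorem sqrt2_pow_eight : Real.sqrt 2 ^ 8 = 16 := by
  rw [pow_succ, sqrt2_pow_seven]; nlinarith [sqrt2_sq]

/-- `√2⁹ = 16√2`. [folklore] -/
theorem sqrt2_pow_nine : Real.sqrt 2 ^ 9 = 16 * Real.sqrt 2 := by rw [pow_succ, sqrt2_pow_eight]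

/-- `√2¹⁰ = 32`. [folklore] -/
theorem sqrt2_pow_ten : Real.sqrt 2 ^ 10 = 32 := by
  rw [pow_succ, sqrt2_pow_nine]; nlinarith [sqrt2_sq]

/-- `√2¹¹ = 32√2`. [folklore] -/
theorem sqrt2_pow_eleven : Real.sqrt 2 ^ 11 = 32 * Real.sqrt 2 := by rw [pow_succ, sqrt2_pow_ten]

/-- `√2¹² = 64`. [folklore] -/
theorem sqrt2_pow_twelve : Real.sqrt 2 ^ 12 = 64 := by
  rw [pow_succ, sqrt2_pow_eleven]; nlinarith [sqrt2_sq]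

/-- `1 < √2`. [folklore] -/
theorem one_lt_sqrt2 : 1 < Real.sqrt 2 := by
  rw [show (1 : ℝ) = Real.sqrt 1 by simp]
  exact Real.sqrt_lt_sqrt (by norm_num) (by norm_num)

/-- `√2 < 2`. [folklore] -/
theorem sqrt2_lt_two : Real.sqrt 2 < 2 := by
  nlinarith [sqrt2_sq, sqrt2_pos]

/-- `k² = (√(√2)/2)² = √2/4`. [folklore] -/
theorem hierK_sq' : (Real.sqrt (Real.sqrt 2) / 2) ^ 2 = Real.sqrt 2 / 4 := by
  rw [div_pow, Real.sq_sqrt sqrt2_pos.le]; norm_num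

/-- `β(√2) = 1/√2 - 1/2 = (√2 - 1)/2`. [cite: HaraHattoriWatanabe2001, §1 eq. (1.1) with (1.4)] -/
theorem beta_sqrt2 : beta (Real.sqrt 2) = (Real.sqrt 2 - 1) / 2 := by
  have hs : Real.sqrt 2 ≠ 0 := sqrt2_pos.ne'
  rw [beta]
  field_simp
  linarith [sqrt2_sq]

namespace StepHyp

variable {ν : Measure ℝ}

/-- The doubled law is bounded. [folklore] -/
theorem bdd_dbl (h : StepHyp ν) : IsBddLaw (dbl ν) := (h.bdd.conv).map_const_mul _

/-- `μ_2(S ν) = μ_2/√2`. [cite: HaraHattoriWatanabe2001, §3.1 (p. 7, `μ_2(0) = μ_{2,N}/√2`)] -/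
theorem mu2_dbl (h : StepHyp ν) : mu2 (dbl ν) = Real.sqrt 2 / 2 * mu2 ν := by
  rw [dbl, h.bdd.mu2_dbl h.odd, hierK_sq']; ring

/-- `μ_4(S ν) = μ_4/4`. [cite: HaraHattoriWatanabe2001, §3.1 (p. 7, `μ_4(0) = μ_{4,N}/4`)] -/
theorem mu4_dbl (h : StepHyp ν) : mu4 (dbl ν) = mu4 ν / 4 := by
  rw [dbl, h.bdd.mu4_dbl h.odd, show (4 : ℕ) = 2 * 2 from rfl, pow_mul, hierK_sq', div_pow,
    sqrt2_sq]
  ring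

/-- `μ_6(S ν) = μ_6/(8√2) = √2 μ_6/16`.
[cite: HaraHattoriWatanabe2001, §3.1 (p. 7, `μ_6(0) = μ_{6,N}/(8√2)`)] -/
theorem mu6_dbl (h : StepHyp ν) : mu6 (dbl ν) = Real.sqrt 2 / 16 * mu6 ν := by
  rw [dbl, h.bdd.mu6_dbl h.odd, show (6 : ℕ) = 2 * 3 from rfl, pow_mul, hierK_sq', div_pow,
    sqrt2_pow_three]
  ring

/-- `μ_8(S ν) = μ_8/32`. [cite: HaraHattoriWatanabe2001, §3.1 (p. 7, `μ_8(0) = μ_{8,N}/32`)] -/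
theorem mu8_dbl (h : StepHyp ν) : mu8 (dbl ν) = mu8 ν / 32 := by
  rw [dbl, h.bdd.mu8_dbl h.odd, show (8 : ℕ) = 2 * 4 from rfl, pow_mul, hierK_sq', div_pow,
    sqrt2_pow_four]
  ring

/-- The denominator of `r_N` is positive under (3.13).
[cite: HaraHattoriWatanabe2001, Proposition 3.1 (3.11), (3.13)] -/
theorem den_pos (h : StepHyp ν) : 0 < Real.sqrt 2 - (Real.sqrt 2 - 1) * mu2 ν := by
  have h1 := h.subcrit
  have h2 := one_lt_sqrt2
  -- `(√2 - 1)(2 + √2) = √2`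
  nlinarith [sqrt2_sq, mul_lt_mul_of_pos_left h1 (sub_pos.2 h2)]

/-- `r_N > 0`. [cite: HaraHattoriWatanabe2001, Proposition 3.1 (3.11)] -/
theorem rN_pos (h : StepHyp ν) : 0 < rN (mu2 ν) := by
  unfold rN; exact div_pos one_pos h.den_pos

/-- `1 - 4aT = (√2 - (√2-1)μ_2)/√2` for `a = μ_2/√2`, `T = β/2`. [folklore] -/
theorem D_eq (h : StepHyp ν) :
    1 - 4 * mu2 (dbl ν) * (beta (Real.sqrt 2) / 2) =
      (Real.sqrt 2 - (Real.sqrt 2 - 1) * mu2 ν) / Real.sqrt 2 := by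
  rw [h.mu2_dbl, beta_sqrt2, eq_div_iff sqrt2_pos.ne']
  ring_nf
  simp only [sqrt2_sq, sqrt2_pow_three]
  ring

/-- **`M(β/2) = √2 r_N`**. [cite: HaraHattoriWatanabe2001, §3.2 (p. 10, `M(β/2) = √2 r_N`)] -/
theorem bigM_eq (h : StepHyp ν) :
    bigM (mu2 (dbl ν)) (beta (Real.sqrt 2) / 2) = Real.sqrt 2 * rN (mu2 ν) := by
  rw [bigM, h.D_eq, rN, inv_div]; ring

/-- **`ζ(β/2) = (1 - 1/√2) r_N`**. [cite: HaraHattoriWatanabe2001, §3.2 (p. 10) and §4 (4.5)] -/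
theorem zetaF_eq (h : StepHyp ν) :
    zetaF (mu2 (dbl ν)) (beta (Real.sqrt 2) / 2) = (1 - Real.sqrt 2 / 2) * rN (mu2 ν) := by
  have hD := h.den_pos.ne'
  rw [zetaF, h.D_eq, rN, beta_sqrt2]
  field_simp
  ring_nf
  simp only [sqrt2_sq]
  ring

/-- **`ζ_N = (1 - 1/√2) r_N`** ((3.12) versus (4.5)–(4.6)).
[cite: HaraHattoriWatanabe2001, Proposition 3.1 (3.12) and §4 (4.5)–(4.6)] -/
theorem zetaN_eq (h : StepHyp ν) : zetaN (mu2 ν) = (1 - Real.sqrt 2 / 2) * rN (mu2 ν) := by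
  have hD := h.den_pos.ne'
  have h2 := h.two_pos.ne'
  have hs := sqrt2_pos.ne'
  rw [zetaN, rN]
  field_simp
  ring_nf
  simp only [sqrt2_sq]
  ring

/-- (3.13) is the subcriticality `4 a T < 1` of the flow.
[cite: HaraHattoriWatanabe2001, Proposition 3.1 (3.13)] -/
theorem subcrit' (h : StepHyp ν) : 4 * mu2 (dbl ν) * (beta (Real.sqrt 2) / 2) < 1 := by
  have : 0 < 1 - 4 * mu2 (dbl ν) * (beta (Real.sqrt 2) / 2) := by
    rw [h.D_eq]; exact div_pos h.den_pos sqrt2_pos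
  linarith

/-- `β/2 > 0`. [folklore] -/
theorem T_pos : 0 < beta (Real.sqrt 2) / 2 := by
  rw [beta_sqrt2]; linarith [one_lt_sqrt2]

/-- **The flow of Proposition 3.1**: the tilted truncated correlations of `S ν` on `[0, β/2]`.
[cite: HaraHattoriWatanabe2001, Proposition 3.1] -/
theorem flow (h : StepHyp ν) :
    TruncFlow (beta (Real.sqrt 2) / 2) (fun t => mu2 (sqTilt (dbl ν) t))
      (fun t => mu4 (sqTilt (dbl ν) t)) (fun t => mu6 (sqTilt (dbl ν) t))
      (fun t => mu8 (sqTilt (dbl ν) t)) (fun t => mu10 (sqTilt (dbl ν) t)) :=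
  h.bdd_dbl.truncFlow_sqTilt T_pos h.pos h.subcrit'

/-- `R ν = (S ν)_{β/2}`. [cite: HaraHattoriWatanabe2001, §2.1 eq. (2.3)] -/
theorem rgMap_eq (ν : Measure ℝ) :
    rgMap (Real.sqrt 2) ν = sqTilt (dbl ν) (beta (Real.sqrt 2) / 2) := rfl

/-- **(3.14)**: `μ_{2,N+1} ≤ r_N μ_{2,N}`. [cite: HaraHattoriWatanabe2001, Proposition 3.1 (3.14)] -/
theorem ineq314 (h : StepHyp ν) : mu2 (rgMap (Real.sqrt 2) ν) ≤ rN (mu2 ν) * mu2 ν := by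
  haveI := h.bdd_dbl.isProbabilityMeasure
  have key := h.flow.two_T_le
  simp only [sqTilt_zero] at key
  rw [h.bigM_eq, h.mu2_dbl, ← rgMap_eq] at key
  convert key using 1
  ring_nf
  simp only [sqrt2_sq]
  ring

/-- **(3.15)**: `μ_{2,N+1} ≥ r_N μ_{2,N} - 3 r_N² ζ_N μ_{4,N}`.
[cite: HaraHattoriWatanabe2001, Proposition 3.1 (3.15)] -/
theorem ineq315 (h : StepHyp ν) :
    rN (mu2 ν) * mu2 ν - 3 * rN (mu2 ν) ^ 2 * zetaN (mu2 ν) * mu4 ν ≤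
      mu2 (rgMap (Real.sqrt 2) ν) := by
  haveI := h.bdd_dbl.isProbabilityMeasure
  have key := h.flow.two_T_ge
  simp only [sqTilt_zero] at key
  rw [h.bigM_eq, h.zetaF_eq, h.mu2_dbl, h.mu4_dbl, ← rgMap_eq] at key
  convert key using 1
  rw [h.zetaN_eq]
  ring_nf
  simp only [sqrt2_sq, sqrt2_pow_three]
  ring

/-- **(3.19)**: `μ_{2,N+1} ≤ r_N μ_{2,N} - 3r_N²(ζ_N μ_{4,N} - (15/(4√2)) ζ_N² μ_{6,N} - 8 ζ_N³ μ²_{4,N})`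
(`15/(4√2) = 15√2/8`). [cite: HaraHattoriWatanabe2001, Proposition 3.1 (3.19)] -/
theorem ineq319 (h : StepHyp ν) :
    mu2 (rgMap (Real.sqrt 2) ν) ≤ rN (mu2 ν) * mu2 ν -
      3 * rN (mu2 ν) ^ 2 * (zetaN (mu2 ν) * mu4 ν -
        15 * Real.sqrt 2 / 8 * zetaN (mu2 ν) ^ 2 * mu6 ν - 8 * zetaN (mu2 ν) ^ 3 * mu4 ν ^ 2) := by
  haveI := h.bdd_dbl.isProbabilityMeasure
  have key := h.flow.two_T_le'
  simp only [sqTilt_zero] at key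
  rw [h.bigM_eq, h.zetaF_eq, h.mu2_dbl, h.mu4_dbl, h.mu6_dbl, ← rgMap_eq] at key
  convert key using 1
  rw [h.zetaN_eq]
  ring_nf
  simp only [sqrt2_sq, sqrt2_pow_three, sqrt2_pow_four, sqrt2_pow_five]
  ring

/-- **(3.20)**: `μ_{4,N+1} ≥ r_N⁴(μ_{4,N} - (15/(2√2)) ζ_N μ_{6,N} - 21 ζ_N² μ²_{4,N})`
(`15/(2√2) = 15√2/4`). [cite: HaraHattoriWatanabe2001, Proposition 3.1 (3.20)] -/
theorem ineq320 (h : StepHyp ν) :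
    rN (mu2 ν) ^ 4 * (mu4 ν - 15 * Real.sqrt 2 / 4 * zetaN (mu2 ν) * mu6 ν -
      21 * zetaN (mu2 ν) ^ 2 * mu4 ν ^ 2) ≤ mu4 (rgMap (Real.sqrt 2) ν) := by
  haveI := h.bdd_dbl.isProbabilityMeasure
  have key := h.flow.four_T_ge
  simp only [sqTilt_zero] at key
  rw [h.bigM_eq, h.zetaF_eq, h.mu4_dbl, h.mu6_dbl, ← rgMap_eq] at key
  convert key using 1
  rw [h.zetaN_eq]
  ring_nf
  simp only [sqrt2_sq, sqrt2_pow_four, sqrt2_pow_five, sqrt2_pow_six]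
  ring

/-- **(3.21)** under **(3.16)** `μ_{4,N}/4 ≥ (15/(8√2)) ζ_N μ_{6,N} + (21/4) ζ_N² μ²_{4,N}`
(`15/(8√2) = 15√2/16`):
`μ_{4,N+1} ≤ r_N⁴(μ_{4,N} - (15/(2√2))ζ_Nμ_{6,N} - 21ζ_N²μ²_{4,N} + (105/4)ζ_N²μ_{8,N}
 + (705/(2√2))ζ_N³μ_{4,N}μ_{6,N} + 447ζ_N⁴μ³_{4,N})` (`705/(2√2) = 705√2/4`); the paper's further
hypotheses (3.17), (3.18) are not needed. [cite: HaraHattoriWatanabe2001, Proposition 3.1 (3.16), (3.21)] -/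
theorem ineq321 (h : StepHyp ν)
    (h16 : 15 * Real.sqrt 2 / 16 * zetaN (mu2 ν) * mu6 ν + 21 / 4 * zetaN (mu2 ν) ^ 2 * mu4 ν ^ 2 ≤
      mu4 ν / 4) :
    mu4 (rgMap (Real.sqrt 2) ν) ≤ rN (mu2 ν) ^ 4 * (mu4 ν -
      15 * Real.sqrt 2 / 4 * zetaN (mu2 ν) * mu6 ν - 21 * zetaN (mu2 ν) ^ 2 * mu4 ν ^ 2 +
      105 / 4 * zetaN (mu2 ν) ^ 2 * mu8 ν +
      705 * Real.sqrt 2 / 4 * zetaN (mu2 ν) ^ 3 * mu4 ν * mu6 ν +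
      447 * zetaN (mu2 ν) ^ 4 * mu4 ν ^ 3) := by
  haveI := h.bdd_dbl.isProbabilityMeasure
  have h16' : 0 ≤ (fun t => mu4 (sqTilt (dbl ν) t)) 0 -
      15 * (fun t => mu6 (sqTilt (dbl ν) t)) 0 * zetaF ((fun t => mu2 (sqTilt (dbl ν) t)) 0)
        (beta (Real.sqrt 2) / 2) -
      84 * (fun t => mu4 (sqTilt (dbl ν) t)) 0 ^ 2 *
        zetaF ((fun t => mu2 (sqTilt (dbl ν) t)) 0) (beta (Real.sqrt 2) / 2) ^ 2 := by
    simp only [sqTilt_zero]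
    rw [h.zetaF_eq, h.mu4_dbl, h.mu6_dbl]
    rw [h.zetaN_eq] at h16
    have e : mu4 ν / 4 - 15 * (Real.sqrt 2 / 16 * mu6 ν) * ((1 - Real.sqrt 2 / 2) * rN (mu2 ν)) -
        84 * (mu4 ν / 4) ^ 2 * ((1 - Real.sqrt 2 / 2) * rN (mu2 ν)) ^ 2 =
        mu4 ν / 4 - (15 * Real.sqrt 2 / 16 * ((1 - Real.sqrt 2 / 2) * rN (mu2 ν)) * mu6 ν +
          21 / 4 * ((1 - Real.sqrt 2 / 2) * rN (mu2 ν)) ^ 2 * mu4 ν ^ 2) := by ring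
    rw [e]
    linarith
  have key := h.flow.four_T_le h16'
  simp only [sqTilt_zero] at key
  rw [h.bigM_eq, h.zetaF_eq, h.mu4_dbl, h.mu6_dbl, h.mu8_dbl, ← rgMap_eq] at key
  convert key using 1
  rw [h.zetaN_eq]
  ring_nf
  simp only [sqrt2_sq, sqrt2_pow_three, sqrt2_pow_four, sqrt2_pow_five, sqrt2_pow_six, sqrt2_pow_seven, sqrt2_pow_eight]
  ring

/-- **(3.22)**: `μ_{6,N+1} ≤ r_N⁶(μ_{6,N}/√2 + 4 ζ_N μ²_{4,N})` (`1/√2 = √2/2`).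
[cite: HaraHattoriWatanabe2001, Proposition 3.1 (3.22)] -/
theorem ineq322 (h : StepHyp ν) :
    mu6 (rgMap (Real.sqrt 2) ν) ≤
      rN (mu2 ν) ^ 6 * (Real.sqrt 2 / 2 * mu6 ν + 4 * zetaN (mu2 ν) * mu4 ν ^ 2) := by
  haveI := h.bdd_dbl.isProbabilityMeasure
  have key := h.flow.six_T_le
  simp only [sqTilt_zero] at key
  rw [h.bigM_eq, h.zetaF_eq, h.mu4_dbl, h.mu6_dbl, ← rgMap_eq] at key
  convert key using 1
  rw [h.zetaN_eq]
  ring_nf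
  simp only [sqrt2_pow_six, sqrt2_pow_seven]
  ring

/-- **(3.23)**: `μ_{6,N+1} ≥ r_N⁶(μ_{6,N}/√2 + 4ζ_Nμ²_{4,N} - 192ζ_N³μ³_{4,N} - (123/√2)ζ_N²μ_{4,N}μ_{6,N}
- 7ζ_Nμ_{8,N})` (`123/√2 = 123√2/2`). [cite: HaraHattoriWatanabe2001, Proposition 3.1 (3.23)] -/
theorem ineq323 (h : StepHyp ν) :
    rN (mu2 ν) ^ 6 * (Real.sqrt 2 / 2 * mu6 ν + 4 * zetaN (mu2 ν) * mu4 ν ^ 2 -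
      192 * zetaN (mu2 ν) ^ 3 * mu4 ν ^ 3 - 123 * Real.sqrt 2 / 2 * zetaN (mu2 ν) ^ 2 * mu4 ν * mu6 ν -
      7 * zetaN (mu2 ν) * mu8 ν) ≤ mu6 (rgMap (Real.sqrt 2) ν) := by
  haveI := h.bdd_dbl.isProbabilityMeasure
  have key := h.flow.six_T_ge
  simp only [sqTilt_zero] at key
  rw [h.bigM_eq, h.zetaF_eq, h.mu4_dbl, h.mu6_dbl, h.mu8_dbl, ← rgMap_eq] at key
  convert key using 1
  rw [h.zetaN_eq]
  ring_nf
  simp only [sqrt2_sq, sqrt2_pow_three, sqrt2_pow_six, sqrt2_pow_seven, sqrt2_pow_eight, sqrt2_pow_nine]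
  ring

/-- **(3.24)**: `μ_{8,N+1} ≤ r_N⁸(μ_{8,N}/2 + (12/√2)ζ_Nμ_{4,N}μ_{6,N} + 24ζ_N²μ³_{4,N})`
(`12/√2 = 6√2`). [cite: HaraHattoriWatanabe2001, Proposition 3.1 (3.24)] -/
theorem ineq324 (h : StepHyp ν) :
    mu8 (rgMap (Real.sqrt 2) ν) ≤ rN (mu2 ν) ^ 8 * (mu8 ν / 2 +
      6 * Real.sqrt 2 * zetaN (mu2 ν) * mu4 ν * mu6 ν + 24 * zetaN (mu2 ν) ^ 2 * mu4 ν ^ 3) := by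
  haveI := h.bdd_dbl.isProbabilityMeasure
  have key := h.flow.eight_T_le
  simp only [sqTilt_zero] at key
  rw [h.bigM_eq, h.zetaF_eq, h.mu4_dbl, h.mu6_dbl, h.mu8_dbl, ← rgMap_eq] at key
  convert key using 1
  rw [h.zetaN_eq]
  ring_nf
  simp only [sqrt2_sq, sqrt2_pow_eight, sqrt2_pow_nine, sqrt2_pow_ten]
  ring

end StepHyp

end HierarchicalRG

end Literature.Barriers.CriticalPhenomena
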